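import Summits.BirchSwinnertonDyer.BirchSwinnertonDyer.Theorems.ThetaPartnerAtTwoSignedMainConjectureCMTwoRankZeroNecessity
import HarnessLib

/-!
# Route `ThetaPartnerAtTwo`, crux K2r `SignedMainConjectureCMTwoRankZero` (item stmt-BirchSwinnertonDyer-20312):
# the skeleton line `rankzero` is LOSSLESS — granted the cited published inputs, the crux at a curve `A`
# is EQUIVALENT to the conjunction of its four research stubs at `A`

HONEST FRAMING (cell `pub/bsd-wall`, W-ALL row 1, prover seat `bsd-wall-tp2-p2`, successor g2): the crux
(Pollack–Rubin 2004 Thm. 7.3 ported to `p = 2` with `μ⁺ = 0`, for CM curves of analytic rank `0`, good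
supersingular at `2`, `a₂ = 0`) is NOT in print at `2` and is NOT proved here. The companion file
`…RankZeroNecessity.lean` proves crux ⇒ each research stub at the curve; this file redoes the
composition of p518019 §4 with Kim's control term consumed only where the proof uses it and assembles
the EQUIVALENCE:

* §4 `valuation_constantCoeff_generator_eq_of_kimTerm_at`,
  `kobayashiMainConjecture_two_one_conclusion_of_lowerDivisibility_of_kimTerm_at`,
  `signedMainConjectureCMTwo_at_rankZero_of_rankzero_stubs` — the rank-zero rigidity composition
  (p518019) with Kim's term required only AT THE DATUM (hence only at the NORMALISED cyclotomic
  pairs), torsion derived from finite invariants (p527678) and `μ⁺ = 0` moved to all top-generator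
  pairs by the landed signed generator change (p526353): (T2_A) + (K4c_A, normalised) + (E_A) + (μ♭_A)
  + PUB ⇒ the crux's body at `A`.
* §5 `rankzero_stubs_of_signedMainConjectureCMTwo_at` (crux at `A` + PUB ⇒ the four stub bodies at
  `A`) and `signedMainConjectureCMTwoRankZero_body_iff_rankzero_stubs`: granted PUB (Burungale–Flach,
  modularity ×2, GZK, the `p = 2` period fact — all by name), the crux's `∀A` body (VERBATIM the route
  decl `SignedMainConjectureCMTwoRankZero`; no `Theses` module is imported) is EQUIVALENT to the
  conjunction of the four `∀A` stub statements of the registered skeleton (K4c with the one extra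
  binder `IsCyclotomicVariable 2 γ`).
Consequences for the line: a refutation of ANY stub refutes the crux itself (no reshaping inside this
composition can save it), and the research content of K2r is EXACTLY {bottom-layer signed control at
`2`, Kim's term at `2`, the inert-`2` Eisenstein half, analytic `μ(L♭) = 0`} for rank-`0` CM curves —
the first two being the CM-partner copies of cruxes K4/K1's inputs of the same route, the third
Pollack–Rubin §§4–7 at `2` (the two-variable main conjecture over `K` at `2` being in print:
Johnson-Leung–Kings 2011 as used in Burungale–Flach 2024 Thm. 4.1), the fourth kit-certified on 25
anchors only. Nothing about any curve is asserted; every research input is a displayed binder.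

References: [PollackRubin2004] Thm. 7.3 (p > 2 in print); [Kobayashi2003] Thm. 1.2, Conjecture (p. 2);
[BDKim2013] Cor. 3.15 (p odd in print); [BurungaleFlach2024] Thm. 1.1 and Thm. 4.1; [GreenbergLNM1716]
Lemma 4.2; [Miller2011LMS] Def. 1.1.
-/

set_option autoImplicit false
-- the Theorems namespace of this sub repeats the summit name by design (D-0017 nested layout)
set_option linter.dupNamespace false

noncomputable section

open scoped Classical MatrixGroups ModularForm

open CongruenceSubgroup WeierstrassCurve Literature.NumberTheory.EllipticCurves
  Literature.NumberTheory.EllipticCurves.ModularForms Literature.NumberTheory.EllipticCurves.Sprung2017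
  Literature.NumberTheory.EllipticCurves.Rank1Residual Literature.NumberTheory.EllipticCurves.Rank1Residual.Typed
  Literature.NumberTheory.EllipticCurves.Kobayashi2003 ZpExtension
  Literature.NumberTheory.EllipticCurves.IwasawaDual
  Summit.BirchSwinnertonDyer.Rank1Residual Summit.BirchSwinnertonDyer.Rank1Residual.Supersingular

namespace Summit.BirchSwinnertonDyer.BirchSwinnertonDyer.Theorems

/-! ## §4. Sufficiency with Kim's term at the NORMALISED pairs only (variant of p518019 §4) -/

section Sufficiency
variable (A : WeierstrassCurve ℚ) [A.IsElliptic] [A.IsGloballyMinimal]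

/-- **`ord₂ g(0) = ord₂ L(W,1)/Ω_W` from BSD₂ + GZK + Kim's term AT ONE DATUM.** The statement of
p518019's private `valuation_constantCoeff_generator_aux` / p509213's
`valuation_constantCoeff_generator_eq_of_bsdp_two` (good supersingular at `2`, `L(W,1) ≠ 0`, `BSDp W 2`,
GZK), with Kim's control term consumed only for THE element `g` at hand (`hK`: if `Sel_{2^∞}(W/ℚ)` is
finite then `g(0) = u·2^{v₂ ∏c}·#Sel_{2^∞}`), not as a `∀`-statement over all pairs and data: then
`g(0) ≠ 0` and `ord₂ g(0) = ord₂ t` for `L(W,1)/Ω_W = t` (`valuation_constantCoeff_xi` on the datum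
`ξ := g`; BSD₂ bookkeeping as in the siblings). [cite: BDKim2013, Cor. 3.15 (p. 199; p odd in print)]
[cite: Miller2011LMS, Def. 1.1] -/
theorem valuation_constantCoeff_generator_eq_of_kimTerm_at
    (hGZK : rank_eq_analyticRank_of_analyticRank_le_one)
    (hss : GoodSS A 2) (hL : A.entireLFunction 1 ≠ 0) (hBSD : BSDp A 2)
    {g : IwasawaAlgebra 2}
    (hK : Finite (A.selmerGroupPInfty 2) →
      ∃ u : ℤ_[2]ˣ, ((PowerSeries.constantCoeff g : ℤ_[2]) : ℚ_[2]) =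
        ((u : ℤ_[2]) : ℚ_[2]) * ((2 : ℕ) : ℚ_[2]) ^ (padicValNat 2 A.tamagawaProduct) *
          (Nat.card (A.selmerGroupPInfty 2) : ℚ_[2]))
    {t : ℚ} (ht : A.entireLFunction 1 / (A.realPeriodRat : ℂ) = (t : ℂ)) :
    ((PowerSeries.constantCoeff g : ℤ_[2]) : ℚ_[2]) ≠ 0 ∧
      (((PowerSeries.constantCoeff g : ℤ_[2]) : ℚ_[2])).valuation = padicValRat 2 t := by
  have hr : A.analyticRank = 0 := analyticRank_eq_zero_of_entireLFunction_one_ne_zero A hL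
  have hirr : A.HasIrreducibleModPGaloisRep 2 := P2.irr_two_of_goodSS_two A hss
  have hΩ : (A.realPeriodRat : ℂ) ≠ 0 := Complex.ofReal_ne_zero.mpr A.realPeriodRat_pos_holds.ne'
  have ht0 : t ≠ 0 := by
    rintro rfl
    apply hL
    have h := ht
    rw [div_eq_iff hΩ] at h
    rw [h]
    simp
  have hKD : (⟨g, 0, 0⟩ : SignedDatum A 2).EulerCharacteristic := fun hfin ↦ hK hfin
  obtain ⟨hne, hvg⟩ := valuation_constantCoeff_xi A 2 hGZK hL ⟨g, 0, 0⟩ hKD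
  haveI : Finite A.sha := (hGZK A (by omega)).2
  obtain ⟨q, hq, hv⟩ := missingPPartAt_of_bsdp A 2 hBSD
  have hsha := shaAn_eq_of_analyticRank_eq_zero A hGZK hr ht
  have hqt : q = t * (A.torsionOrder : ℚ) ^ 2 / (A.tamagawaProduct : ℚ) := by
    have h := hq.symm.trans hsha
    exact_mod_cast h
  rw [hqt, padicValRat_shaAn_witness A 2 hirr ht0] at hv
  refine ⟨hne, ?_⟩
  rw [hvg]
  linarith

/-- **The conclusion of the `+` main conjecture at `2` from its Eisenstein half, Kim's term AT THE
DATUM.** Same statement and proof as p518019's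
`kobayashiMainConjecture_two_one_conclusion_of_lowerDivisibility` (good supersingular at `2`, `a₂ = 0`,
`L(W,1) ≠ 0`, GZK, `BSDp W 2`; `char X⁺ = (g)`, `ι g = ϖ·ι(L⁻·h)` ⇒ `char X⁺ = (g')`, `ι g' = ϖ·ι L⁻`),
except that Kim's control term is required only for the generator `g` of THIS datum (`hK`), which is
all the proof uses (`ord₂ g(0) = ord₂ t = ord₂ (ϖ·L⁻)(0)` by the previous theorem and
`constantCoeff_neronPlus_two_eq`; rigidity `exists_generator_eq_of_eq_mul_of_valuation_constantCoeff_eq`).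
[cite: Kobayashi2003, Conjecture (p. 2) and (3.6)] [cite: BDKim2013, Cor. 3.15 (p odd in print)] -/
theorem kobayashiMainConjecture_two_one_conclusion_of_lowerDivisibility_of_kimTerm_at
    (hGZK : rank_eq_analyticRank_of_analyticRank_le_one)
    (hss : GoodSS A 2) (ha : A.frobeniusTrace 2 = 0) (hL : A.entireLFunction 1 ≠ 0)
    (hBSD : BSDp A 2)
    {κ : ZpExtension ℚ 2} {γ : Field.absoluteGaloisGroup ℚ} (D : SignedSelmerDualData A κ γ 1)
    [NeZero (A.conductorNorm ℤ)] {f : CuspForm (Gamma0 (A.conductorNorm ℤ)) 2} (hf : IsNewformOf A f)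
    {ϖ : ℚ} (hϖ : (ϖ : ℝ) * A.realPeriodRat = plusPeriod f)
    {Lplus Lminus : IwasawaAlgebra 2} (hPP : IsPollackPair f 2 Lplus Lminus)
    {g h : IwasawaAlgebra 2} (hchar : D.charIdeal = Ideal.span {g})
    (hK : Finite (A.selmerGroupPInfty 2) →
      ∃ u : ℤ_[2]ˣ, ((PowerSeries.constantCoeff g : ℤ_[2]) : ℚ_[2]) =
        ((u : ℤ_[2]) : ℚ_[2]) * ((2 : ℕ) : ℚ_[2]) ^ (padicValNat 2 A.tamagawaProduct) *
          (Nat.card (A.selmerGroupPInfty 2) : ℚ_[2]))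
    (hdiv : iwasawaToPowerSeries 2 g =
      PowerSeries.C (ϖ : ℚ_[2]) * iwasawaToPowerSeries 2 (kobayashiL 1 Lplus Lminus * h)) :
    ∃ g' : IwasawaAlgebra 2, D.charIdeal = Ideal.span {g'} ∧
      iwasawaToPowerSeries 2 g' =
        PowerSeries.C (ϖ : ℚ_[2]) * iwasawaToPowerSeries 2 (kobayashiL 1 Lplus Lminus) := by
  obtain ⟨hΦ0, ht⟩ := constantCoeff_neronPlus_two_eq A hf hss.1 ha hϖ hPP
  set Φ := PowerSeries.C (ϖ : ℚ_[2]) * iwasawaToPowerSeries 2 (kobayashiL 1 Lplus Lminus) with hΦ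
  obtain ⟨hg0, hval⟩ := valuation_constantCoeff_generator_eq_of_kimTerm_at A hGZK hss hL hBSD hK ht
  have hval' : ((PowerSeries.constantCoeff g : ℤ_[2]) : ℚ_[2]).valuation =
      (PowerSeries.constantCoeff Φ).valuation := by
    rw [hval, hΦ0, Padic.valuation_ratCast]
  have hg : iwasawaToPowerSeries 2 g = Φ * iwasawaToPowerSeries 2 h := by
    rw [hdiv, map_mul, hΦ, mul_assoc]
  exact exists_generator_eq_of_eq_mul_of_valuation_constantCoeff_eq hchar hg
    (PadicInt.coe_ne_zero.mp hg0) hval'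

/-- **Crux K2r at a CM curve of analytic rank `0` from the four stubs of line `rankzero`, Kim's
term at the NORMALISED pairs only.** `A/ℚ` globally minimal, CM, good supersingular at `2`, `a₂ = 0`,
`A.analyticRank = 0`; PUB by name: Burungale–Flach (`hBF`), modularity (`hmod`, `hLrat`), GZK
(`hGZK`), the `p = 2` period fact (`h2`); research binders READ FOR `A`: (T2_A) `hT2`
`Sel⁺(A/ℚ_∞)^γ` finite at the normalised pairs; (K4c_A) `hKim` Kim's control term at `2` at the
NORMALISED pairs (`IsCyclotomicVariable 2 γ`; weaker than the registered all-pairs stub); (E_A) `hlow :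
KobayashiLowerDivisibility A 2 1`; (μ♭_A) `hflat` a unit coefficient of `L♭` for every
newform/Pollack datum. THEN the crux's body at `A`: `X⁺` torsion with `μ⁺ = 0` at EVERY cyclotomic
top-generator pair, and `KobayashiMainConjecture A 2 1`. Composition: torsion at every pair from
(T2_A) (`signedTorsion_of_finite_invariants_normalised`, p527678); the conjecture from (E_A) + Kim AT
THE DATUM (previous theorem; BSD₂(A) = `forall_bsdp_of_bsdTriple` ∘ `hBF`); `μ⁺ = 0` at the normalised
pairs from (μ♭_A) and `ord₂ ϖ = 0` (`muInvariant_eq_zero_of_generator_map_eq_C_mul`,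
`padicValRat_periodRatio_eq_zero_two`), then at every pair by the landed signed generator change
(`stub_generatorChangeCMTwo`, p526353). [cite: PollackRubin2004, Thm. 7.3 (p > 2 in print)]
[cite: Kobayashi2003, Thm. 1.2 and Conjecture (p. 2)] [cite: BDKim2013, Cor. 3.15 (p odd in print)]
[cite: BurungaleFlach2024, Thm. 1.1] -/
theorem signedMainConjectureCMTwo_at_rankZero_of_rankzero_stubs
    (hBF : bsdTriple_of_hasCM_of_L_one_ne_zero)
    (hmod : nonempty_modularParametrizationData) (hLrat : hasEntireLFunction_rat)
    (hGZK : rank_eq_analyticRank_of_analyticRank_le_one)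
    (h2 : Literature.NumberTheory.EllipticCurves.realPeriodRat_eq_unit_mul_plusPeriod_two)
    (hcm : A.HasCM) (hss : GoodSS A 2) (ha : A.frobeniusTrace 2 = 0) (hr : A.analyticRank = 0)
    (hT2 : ∀ (κ : ZpExtension ℚ 2) (γ : Field.absoluteGaloisGroup ℚ),
      κ.IsCyclotomic → κ.IsTopGenerator γ → IsCyclotomicVariable 2 γ →
      Finite (endInvariants (conjSignedSelmerInfty A κ 1 γ - 1)))
    (hKim : ∀ (κ : ZpExtension ℚ 2) (γ : Field.absoluteGaloisGroup ℚ),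
      κ.IsCyclotomic → κ.IsTopGenerator γ → IsCyclotomicVariable 2 γ →
      ∀ (D : SignedSelmerDualData A κ γ 1) [Module.Finite (IwasawaAlgebra 2) D.X],
        Module.IsTorsion (IwasawaAlgebra 2) D.X →
      ∀ g : IwasawaAlgebra 2, D.charIdeal = Ideal.span {g} → Finite (A.selmerGroupPInfty 2) →
        ∃ u : ℤ_[2]ˣ, ((PowerSeries.constantCoeff g : ℤ_[2]) : ℚ_[2]) =
          ((u : ℤ_[2]) : ℚ_[2]) * ((2 : ℕ) : ℚ_[2]) ^ (padicValNat 2 A.tamagawaProduct) *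
            (Nat.card (A.selmerGroupPInfty 2) : ℚ_[2]))
    (hlow : KobayashiLowerDivisibility A 2 1)
    (hflat : ∀ [NeZero (A.conductorNorm ℤ)] (f : CuspForm (Gamma0 (A.conductorNorm ℤ)) 2),
      IsNewformOf A f → ∀ (Lplus Lminus : IwasawaAlgebra 2), IsPollackPair f 2 Lplus Lminus →
        ∃ n : ℕ, IsUnit (PowerSeries.coeff n (kobayashiL 1 Lplus Lminus))) :
    (∀ (κ : ZpExtension ℚ 2) (γ : Field.absoluteGaloisGroup ℚ),
      κ.IsCyclotomic → κ.IsTopGenerator γ →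
      ∀ D : SignedSelmerDualData A κ γ 1, Module.IsTorsion (IwasawaAlgebra 2) D.X ∧ D.mu = 0) ∧
    KobayashiMainConjecture A 2 1 := by
  have hL : A.entireLFunction 1 ≠ 0 := (A.analyticRank_eq_zero_iff_holds (hLrat A)).mp hr
  have hBSD : BSDp A 2 :=
    forall_bsdp_of_bsdTriple A A.tamagawaProduct_pos_holds (hBF A hcm hL) 2 Nat.prime_two
  -- torsion at every pair from finite invariants at the normalised pairs (p527678 §1)
  have hTors : ∀ (κ : ZpExtension ℚ 2) (γ : Field.absoluteGaloisGroup ℚ),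
      κ.IsCyclotomic → κ.IsTopGenerator γ →
      ∀ D : SignedSelmerDualData A κ γ 1, Module.IsTorsion (IwasawaAlgebra 2) D.X :=
    fun κ γ hκ _ D => signedTorsion_of_finite_invariants_normalised A 1 hT2 hκ D
  have hMC : KobayashiMainConjecture A 2 1 := by
    intro κ γ hκ hγ hγ' _ f hf ϖ hϖ Lplus Lminus hPP D
    haveI := Kobayashi2003.SignedSelmerDualData.moduleFinite hγ D
    have hTD := hTors κ γ hκ hγ D
    obtain ⟨g, h, hchar, hdiv⟩ := hlow κ γ hκ hγ hγ' f hf ϖ hϖ Lplus Lminus hPP D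
    exact ⟨hTD, kobayashiMainConjecture_two_one_conclusion_of_lowerDivisibility_of_kimTerm_at A hGZK hss
      ha hL hBSD D hf hϖ hPP hchar (hKim κ γ hκ hγ hγ' D hTD g hchar) hdiv⟩
  -- `μ⁺ = 0` at the normalised pairs (§3 of p518019), then at every pair (generator change, p526353)
  have hμnorm : ∀ (κ : ZpExtension ℚ 2) (γ : Field.absoluteGaloisGroup ℚ),
      κ.IsCyclotomic → κ.IsTopGenerator γ → IsCyclotomicVariable 2 γ →
      ∀ D : SignedSelmerDualData A κ γ 1, D.mu = 0 := by
    intro κ γ hκ hγ hγ' D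
    haveI := Kobayashi2003.SignedSelmerDualData.moduleFinite hγ D
    haveI : NeZero (A.conductorNorm ℤ) := ⟨(A.conductorNorm_pos_holds).ne'⟩
    obtain ⟨Dm⟩ := hmod A
    obtain ⟨ϖ, hϖpos, hϖeq, -⟩ := Dm.exists_rat_mul_realPeriodRat_eq_plusPeriod
    obtain ⟨Ls, Lf, -, hPP⟩ := exists_isPollackPair_two Dm.isNewformOf hss.1 ha hL
    obtain ⟨hTD, g, hchar, hg⟩ := hMC κ γ hκ hγ hγ' Dm.f Dm.isNewformOf ϖ hϖeq Ls Lf hPP D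
    exact muInvariant_eq_zero_of_generator_map_eq_C_mul D.X hTD hchar hϖpos.ne'
      (padicValRat_periodRatio_eq_zero_two A h2 hss Dm.isNewformOf hϖeq)
      (hflat Dm.f Dm.isNewformOf Ls Lf hPP) hg
  refine ⟨fun κ γ hκ hγ D => ⟨hTors κ γ hκ hγ D, ?_⟩, hMC⟩
  exact stub_generatorChangeCMTwo A hcm hr hss ha hTors hμnorm κ γ hκ hγ D

end Sufficiency

/-! ## §5. The line is lossless: crux-at-`A` ⟹ every stub at `A`; and the `∀A` equivalence -/

section Lossless
variable (A : WeierstrassCurve ℚ) [A.IsElliptic] [A.IsGloballyMinimal]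

/-- **Crux at `A` ⟹ every research stub of line `rankzero` at `A` (granted PUB).** For `A/ℚ`
globally minimal, CM, good supersingular at `2`, `a₂ = 0`, `A.analyticRank = 0`, with the published
inputs by name (`hBF`, `hmod`, `hLrat`, `hGZK`, `h2`): the crux's body at `A` (`hK2`: `X⁺` torsion with
`μ⁺ = 0` at every cyclotomic top-generator pair, and `KobayashiMainConjecture A 2 1`) implies
(T2_A) `Sel⁺(A/ℚ_∞)^γ` finite at the normalised pairs (§1), (K4c_A at the normalised pairs) Kim's
control term at `2` (§3, BSD₂(A) from `hBF`), (E_A) `KobayashiLowerDivisibility A 2 1`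
(`kobayashiLowerDivisibility_of_mainConjecture`), and (μ♭_A) a unit coefficient of `L♭` for every
newform/Pollack datum (§2). [cite: Kobayashi2003, Conjecture (p. 2)] [cite: BurungaleFlach2024, Thm. 1.1]
[cite: GreenbergLNM1716, §4 Lemma 4.2] -/
theorem rankzero_stubs_of_signedMainConjectureCMTwo_at
    (hBF : bsdTriple_of_hasCM_of_L_one_ne_zero)
    (hmod : nonempty_modularParametrizationData) (hLrat : hasEntireLFunction_rat)
    (hGZK : rank_eq_analyticRank_of_analyticRank_le_one)
    (h2 : Literature.NumberTheory.EllipticCurves.realPeriodRat_eq_unit_mul_plusPeriod_two)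
    (hcm : A.HasCM) (hss : GoodSS A 2) (ha : A.frobeniusTrace 2 = 0) (hr : A.analyticRank = 0)
    (hK2 : (∀ (κ : ZpExtension ℚ 2) (γ : Field.absoluteGaloisGroup ℚ),
        κ.IsCyclotomic → κ.IsTopGenerator γ →
        ∀ D : SignedSelmerDualData A κ γ 1, Module.IsTorsion (IwasawaAlgebra 2) D.X ∧ D.mu = 0) ∧
      KobayashiMainConjecture A 2 1) :
    (∀ (κ : ZpExtension ℚ 2) (γ : Field.absoluteGaloisGroup ℚ),
        κ.IsCyclotomic → κ.IsTopGenerator γ → IsCyclotomicVariable 2 γ →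
        Finite (endInvariants (conjSignedSelmerInfty A κ 1 γ - 1))) ∧
    (∀ (κ : ZpExtension ℚ 2) (γ : Field.absoluteGaloisGroup ℚ),
        κ.IsCyclotomic → κ.IsTopGenerator γ → IsCyclotomicVariable 2 γ →
        ∀ (D : SignedSelmerDualData A κ γ 1) [Module.Finite (IwasawaAlgebra 2) D.X],
          Module.IsTorsion (IwasawaAlgebra 2) D.X →
        ∀ g : IwasawaAlgebra 2, D.charIdeal = Ideal.span {g} → Finite (A.selmerGroupPInfty 2) →
          ∃ u : ℤ_[2]ˣ, ((PowerSeries.constantCoeff g : ℤ_[2]) : ℚ_[2]) =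
            ((u : ℤ_[2]) : ℚ_[2]) * ((2 : ℕ) : ℚ_[2]) ^ (padicValNat 2 A.tamagawaProduct) *
              (Nat.card (A.selmerGroupPInfty 2) : ℚ_[2])) ∧
    KobayashiLowerDivisibility A 2 1 ∧
    (∀ [NeZero (A.conductorNorm ℤ)] (f : CuspForm (Gamma0 (A.conductorNorm ℤ)) 2),
      IsNewformOf A f → ∀ (Lplus Lminus : IwasawaAlgebra 2), IsPollackPair f 2 Lplus Lminus →
        ∃ n : ℕ, IsUnit (PowerSeries.coeff n (kobayashiL 1 Lplus Lminus))) := by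
  have hL : A.entireLFunction 1 ≠ 0 := (A.analyticRank_eq_zero_iff_holds (hLrat A)).mp hr
  have hBSD : BSDp A 2 :=
    forall_bsdp_of_bsdTriple A A.tamagawaProduct_pos_holds (hBF A hcm hL) 2 Nat.prime_two
  refine ⟨fun κ γ hκ hγ hγ' => ?_, fun κ γ hκ hγ hγ' D _ _ g hchar _ => ?_,
    kobayashiLowerDivisibility_of_mainConjecture hK2.2, fun f hf Lplus Lminus hPP => ?_⟩
  · exact finite_signedSelmerInvariants_of_kobayashiMainConjecture_two_one A hmod hss.1 ha hL hK2.2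
      hκ hγ hγ'
  · exact kimControlTerm_two_of_kobayashiMainConjecture_two_one A hmod hGZK hss ha hL hBSD hK2.2
      hκ hγ hγ' D hchar
  · exact exists_isUnit_coeff_kobayashiL_of_mu_eq_zero_two A h2 hss hK2.2
      (fun κ γ hκ hγ _ D => (hK2.1 κ γ hκ hγ D).2) rfl hf hPP

/-- **LOSSLESSNESS OF LINE `rankzero` (kernel certificate).** Granted the five published inputs by
name — Burungale–Flach 2024 (`hBF`), modularity (`hmod`, `hLrat`), Gross–Zagier–Kolyvagin (`hGZK`),
the `p = 2` period-ratio fact (`h2`) — the body of the route decl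
`Theses.ThetaPartnerAtTwo.SignedMainConjectureCMTwoRankZero` (item stmt-BirchSwinnertonDyer-20312,
spelled VERBATIM on the left; this file imports no `Theses` module) is EQUIVALENT to the conjunction
of the four research-stub statements of the registered skeleton `rankzero` (v7, fd96cde8f62ba52b):
`stub_finiteInvariantsCMTwo` (verbatim), `stub_kimControlCMTwo` restricted to the normalised pairs
(one extra binder `IsCyclotomicVariable 2 γ`; the composition never used more),
`stub_lowerDivisibilityCMTwo` (verbatim), `stub_analyticMuFlatCMTwo` (verbatim). `→`: §5
`rankzero_stubs_of_signedMainConjectureCMTwo_at`; `←`: §4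
`signedMainConjectureCMTwo_at_rankZero_of_rankzero_stubs`. So the crux's research content is EXACTLY
these four statements; a refutation of any one refutes the crux. Nothing is asserted about any curve.
[cite: PollackRubin2004, Thm. 7.3 (p > 2 in print)] [cite: Kobayashi2003, Thm. 1.2 and Conjecture (p. 2)]
[cite: BDKim2013, Cor. 3.15 (p odd in print)] [cite: BurungaleFlach2024, Thm. 1.1] -/
theorem signedMainConjectureCMTwoRankZero_body_iff_rankzero_stubs
    (hBF : bsdTriple_of_hasCM_of_L_one_ne_zero)
    (hmod : nonempty_modularParametrizationData) (hLrat : hasEntireLFunction_rat)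
    (hGZK : rank_eq_analyticRank_of_analyticRank_le_one)
    (h2 : Literature.NumberTheory.EllipticCurves.realPeriodRat_eq_unit_mul_plusPeriod_two) :
    (∀ (A : WeierstrassCurve ℚ) [A.IsElliptic] [A.IsGloballyMinimal],
      A.HasCM → A.analyticRank = 0 → GoodSS A 2 → A.frobeniusTrace 2 = 0 →
      (∀ (κ : ZpExtension ℚ 2) (γ : Field.absoluteGaloisGroup ℚ),
        κ.IsCyclotomic → κ.IsTopGenerator γ →
        ∀ D : SignedSelmerDualData A κ γ 1, Module.IsTorsion (IwasawaAlgebra 2) D.X ∧ D.mu = 0) ∧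
      KobayashiMainConjecture A 2 1) ↔
    ((∀ (A : WeierstrassCurve ℚ) [A.IsElliptic] [A.IsGloballyMinimal],
        A.HasCM → A.analyticRank = 0 → GoodSS A 2 → A.frobeniusTrace 2 = 0 →
        ∀ (κ : ZpExtension ℚ 2) (γ : Field.absoluteGaloisGroup ℚ),
          κ.IsCyclotomic → κ.IsTopGenerator γ → IsCyclotomicVariable 2 γ →
          Finite (endInvariants (conjSignedSelmerInfty A κ 1 γ - 1))) ∧
      (∀ (A : WeierstrassCurve ℚ) [A.IsElliptic] [A.IsGloballyMinimal],
        A.HasCM → A.analyticRank = 0 → GoodSS A 2 → A.frobeniusTrace 2 = 0 →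
        ∀ (κ : ZpExtension ℚ 2) (γ : Field.absoluteGaloisGroup ℚ),
          κ.IsCyclotomic → κ.IsTopGenerator γ → IsCyclotomicVariable 2 γ →
        ∀ (D : SignedSelmerDualData A κ γ 1) [Module.Finite (IwasawaAlgebra 2) D.X],
          Module.IsTorsion (IwasawaAlgebra 2) D.X →
        ∀ g : IwasawaAlgebra 2, D.charIdeal = Ideal.span {g} → Finite (A.selmerGroupPInfty 2) →
          ∃ u : ℤ_[2]ˣ, ((PowerSeries.constantCoeff g : ℤ_[2]) : ℚ_[2]) =
            ((u : ℤ_[2]) : ℚ_[2]) * ((2 : ℕ) : ℚ_[2]) ^ (padicValNat 2 A.tamagawaProduct) *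
              (Nat.card (A.selmerGroupPInfty 2) : ℚ_[2])) ∧
      (∀ (A : WeierstrassCurve ℚ) [A.IsElliptic] [A.IsGloballyMinimal],
        A.HasCM → A.analyticRank = 0 → GoodSS A 2 → A.frobeniusTrace 2 = 0 →
        KobayashiLowerDivisibility A 2 1) ∧
      (∀ (A : WeierstrassCurve ℚ) [A.IsElliptic] [A.IsGloballyMinimal],
        A.HasCM → A.analyticRank = 0 → GoodSS A 2 → A.frobeniusTrace 2 = 0 →
        ∀ [NeZero (A.conductorNorm ℤ)] (f : CuspForm (Gamma0 (A.conductorNorm ℤ)) 2),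
        IsNewformOf A f → ∀ (Lplus Lminus : IwasawaAlgebra 2), IsPollackPair f 2 Lplus Lminus →
          ∃ n : ℕ, IsUnit (PowerSeries.coeff n (kobayashiL 1 Lplus Lminus)))) := by
  constructor
  · intro hK2
    refine ⟨fun A _ _ hcm hr hss ha => ?_, fun A _ _ hcm hr hss ha => ?_,
      fun A _ _ hcm hr hss ha => ?_, fun A _ _ hcm hr hss ha => ?_⟩
    · exact (rankzero_stubs_of_signedMainConjectureCMTwo_at A hBF hmod hLrat hGZK h2 hcm hss ha hr
        (hK2 A hcm hr hss ha)).1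
    · exact (rankzero_stubs_of_signedMainConjectureCMTwo_at A hBF hmod hLrat hGZK h2 hcm hss ha hr
        (hK2 A hcm hr hss ha)).2.1
    · exact (rankzero_stubs_of_signedMainConjectureCMTwo_at A hBF hmod hLrat hGZK h2 hcm hss ha hr
        (hK2 A hcm hr hss ha)).2.2.1
    · exact (rankzero_stubs_of_signedMainConjectureCMTwo_at A hBF hmod hLrat hGZK h2 hcm hss ha hr
        (hK2 A hcm hr hss ha)).2.2.2
  · rintro ⟨hT2, hKim, hlow, hflat⟩ A _ _ hcm hr hss ha
    exact signedMainConjectureCMTwo_at_rankZero_of_rankzero_stubs A hBF hmod hLrat hGZK h2 hcm hss ha hr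
      (hT2 A hcm hr hss ha) (hKim A hcm hr hss ha) (hlow A hcm hr hss ha) (hflat A hcm hr hss ha)

end Lossless

end Summit.BirchSwinnertonDyer.BirchSwinnertonDyer.Theorems

end
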